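import Literature.GroupTheory.ArithmeticGroups.SL2PrimePowSchurMultiplier
import Mathlib.GroupTheory.Commutator.Basic
import HarnessLib

/-!
# Beyl's theorem for `p`-group kernels of any exponent (`p ≥ 5`): perfectness of `SL₂(ℤ/p^e)`

`SL2PrimePowSchurMultiplier` proves: central extensions of `SL₂(ℤ/p^e)` (`p ≥ 5`) by groups of EXPONENT `p`
have `ker ∩ [E,E] = 1`.  Here the kernel may be any central subgroup of exponent `p^a`
(`eq_one_of_mem_ker_of_mem_commutator_pgroup`), which is the shape needed by the block certificates of the
invariant form of [CalegariDimitrovTang2025, Corollary 4.5.3] when the target `Q` is a general finite abelian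
`p`-group.  The reduction is the classical one through PERFECTNESS (`commutator_eq_top`: `SL₂(ℤ/p^e)` is
perfect for `p ≥ 5`, via the torus of `SL2PrimePowTopLayer.exists_torus`): the commutator subgroup `D` of `E` is
a perfect central extension, and a perfect central extension with exponent-`p` kernel has trivial kernel by the
exponent-`p` theorem; iterating `K = ⟨K^p⟩` kills a kernel of exponent `p^a`.  [Beyl1986].
Not here: `p = 3` (where `SL₂(ℤ/3^e)` is solvable and this reduction is unavailable).
-/

open scoped MatrixGroups commutatorElement
open Matrix Matrix.SpecialLinearGroup

namespace Literature.GroupTheory.ArithmeticGroups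

namespace SL2SchurMultiplierPGroup

/-- **`SL₂(ℤ/p^e)` is perfect for `p ≥ 5`**: with the torus `D̄ = diag(2,2⁻¹)` one has `[D̄, T̄] = T̄³` and
`[D̄, L̄] = L̄^{b-1}` (`4b = 1`), and `3`, `b - 1 ≡ -3/4` are units modulo `p^e`; so `T̄, L̄ ∈ [Q, Q]` and `Q =
⟨T̄, L̄⟩`. [cite: DiamondShurman2005, Exercise 1.1.1] -/
theorem commutator_eq_top {p e : ℕ} [Fact p.Prime] (hp5 : 5 ≤ p) :
    commutator SL(2, ZMod (p ^ e)) = ⊤ := by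
  have hp : p.Prime := Fact.out
  haveI : NeZero (p ^ e) := ⟨pow_ne_zero _ hp.ne_zero⟩
  set T : SL(2, ZMod (p ^ e)) := ⟨!![1, 1; 0, 1], by simp [Matrix.det_fin_two_of]⟩ with hT
  set L : SL(2, ZMod (p ^ e)) := ⟨!![1, 0; 1, 1], by simp [Matrix.det_fin_two_of]⟩ with hL
  have hTc : (T : Matrix (Fin 2) (Fin 2) (ZMod (p ^ e))) = !![1, 1; 0, 1] := rfl
  have hLc : (L : Matrix (Fin 2) (Fin 2) (ZMod (p ^ e))) = !![1, 0; 1, 1] := rfl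
  obtain ⟨D, b, hDT, hDL, hb⟩ := SL2TopLayer.exists_torus p e (by omega) T L hTc hLc
  -- `[D, T] = T^3` and `[D, L] = L^{b-1}`-type identities give `T^3, L^{b} L^{-1}` commutators
  have hT3 : T ^ 3 ∈ commutator SL(2, ZMod (p ^ e)) := by
    have : T ^ 3 = D * T * D⁻¹ * T⁻¹ := by rw [hDT]; group
    rw [this, ← commutatorElement_def]
    exact Subgroup.commutator_mem_commutator (Subgroup.mem_top D) (Subgroup.mem_top T)
  have hLb : L ^ b * L⁻¹ ∈ commutator SL(2, ZMod (p ^ e)) := by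
    have : L ^ b * L⁻¹ = D * L * D⁻¹ * L⁻¹ := by rw [hDL]
    rw [this, ← commutatorElement_def]
    exact Subgroup.commutator_mem_commutator (Subgroup.mem_top D) (Subgroup.mem_top L)
  -- 3 is invertible mod p^e: T = (T^3)^k
  have h3 : Nat.Coprime 3 (p ^ e) := by
    apply Nat.Coprime.pow_right
    exact (Nat.coprime_primes Nat.prime_three hp).mpr (by omega)
  have hTmem : T ∈ commutator SL(2, ZMod (p ^ e)) := by
    obtain ⟨k, hk⟩ : ∃ k : ℕ, (3 * k : ZMod (p ^ e)) = 1 := by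
      refine ⟨((3 : ZMod (p ^ e))⁻¹).val, ?_⟩
      rw [ZMod.natCast_zmod_val]
      have := ZMod.coe_mul_inv_eq_one 3 h3
      simpa using this
    have : T = (T ^ 3) ^ k := by
      rw [← pow_mul]
      ext i j
      rw [SL2TopLayer.tBar_pow T hTc, hTc]
      fin_cases i <;> fin_cases j <;> simp
      · rw [hk]
    rw [this]
    exact Subgroup.pow_mem _ hT3 k
  have hLmem : L ∈ commutator SL(2, ZMod (p ^ e)) := by
    -- 4b = 1 ⇒ b - 1 ≡ -3/4 is a unit; L^(b-1) ∈ commutator with exponent (b - 1) as an integer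
    have hLz : L ^ ((b : ℤ) - 1) ∈ commutator SL(2, ZMod (p ^ e)) := by
      rw [_root_.zpow_sub_one, zpow_natCast]; exact hLb
    -- (4 : ZMod) * (b - 1) = 1 - 4 = -3, so (b - 1) is invertible
    obtain ⟨k, hk⟩ : ∃ k : ℤ, ((((b : ℤ) - 1) * k : ℤ) : ZMod (p ^ e)) = 1 := by
      obtain ⟨k3, hk3⟩ : ∃ k : ℕ, (3 * k : ZMod (p ^ e)) = 1 := by
        refine ⟨((3 : ZMod (p ^ e))⁻¹).val, ?_⟩
        rw [ZMod.natCast_zmod_val]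
        have := ZMod.coe_mul_inv_eq_one 3 h3
        simpa using this
      refine ⟨-(4 * (k3 : ℤ)), ?_⟩
      push_cast
      have h4 : (4 : ZMod (p ^ e)) * (b : ZMod (p ^ e)) = 1 := hb
      linear_combination (-(k3 : ZMod (p ^ e))) * h4 + hk3
    have : L = (L ^ ((b : ℤ) - 1)) ^ k := by
      rw [← _root_.zpow_mul]
      ext i j
      have hLpow : ∀ n : ℤ, ((L ^ n : SL(2, ZMod (p ^ e))) : Matrix (Fin 2) (Fin 2) (ZMod (p ^ e))) =
          !![1, 0; (n : ZMod (p ^ e)), 1] := by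
        intro n
        induction n using Int.induction_on with
        | zero => ext i j; fin_cases i <;> fin_cases j <;> simp
        | succ n ih =>
          rw [_root_.zpow_add_one, coe_mul, ih, hLc]
          ext i j; fin_cases i <;> fin_cases j <;> simp [Matrix.mul_apply, Fin.sum_univ_two]
        | pred n ih =>
          rw [_root_.zpow_sub_one, coe_mul, ih, Matrix.SpecialLinearGroup.coe_inv, hLc]
          ext i j; fin_cases i <;> fin_cases j <;>
            simp [Matrix.mul_apply, Fin.sum_univ_two, Matrix.adjugate_fin_two]; ring
      rw [hLpow, hLc]
      fin_cases i <;> fin_cases j <;> simp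
      exact_mod_cast hk.symm
    rw [this]
    exact Subgroup.zpow_mem _ hLz k
  rw [eq_top_iff, ← SL2TopLayer.closure_T_L_eq_top (p ^ e) T L hTc hLc, Subgroup.closure_le]
  intro x hx
  simp only [Set.mem_insert_iff, Set.mem_singleton_iff] at hx
  rcases hx with rfl | rfl
  · exact hTmem
  · exact hLmem


universe u

/-- **Theorem (Beyl, `p`-group kernels).** For a prime `p ≥ 5`, every `e`, and every surjection `π : E →
SL₂(ℤ/p^e)` whose kernel is central and of exponent `p^a` (any `a`): `ker π ∩ [E, E] = 1`.  Reduction to the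
exponent-`p` theorem `SL2SchurMultiplier.eq_one_of_mem_ker_of_mem_commutator` by perfectness: `D = [E, E]` is
perfect and maps onto the perfect group `SL₂(ℤ/p^e)`; for `K = D ∩ ker π` the quotient `D/⟨K^p⟩` is a perfect
central exponent-`p` extension, so `K = ⟨K^p⟩`, whence `K = ⟨K^{p^a}⟩ = 1`.  This is the form consumed by the
block certificates of the invariant form of [CalegariDimitrovTang2025, Cor. 4.5.3] (targets of `p`-power
exponent). [cite: Beyl1986, Theorem (M(SL(2,ℤ/m)) = 0 for 4 ∤ m), p-primary part] -/
theorem eq_one_of_mem_ker_of_mem_commutator_pgroup (p : ℕ) [Fact p.Prime] (hp5 : 5 ≤ p) (e a : ℕ)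
    {E : Type u} [Group E] (π : E →* SL(2, ZMod (p ^ e))) (hsurj : Function.Surjective π)
    (hcen : ∀ z : E, π z = 1 → ∀ g : E, g * z = z * g) (hexp : ∀ z : E, π z = 1 → z ^ (p ^ a) = 1)
    {z : E} (hz : π z = 1) (hzc : z ∈ commutator E) : z = 1 := by
  have hp : p.Prime := Fact.out
  set D : Subgroup E := commutator E with hD
  -- every element of E is d * ζ with d ∈ D, ζ in the kernel
  have hdec : ∀ g : E, ∃ d : E, d ∈ D ∧ ∃ ζ : E, π ζ = 1 ∧ g = d * ζ := by
    intro g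
    have hg : π g ∈ (commutator E).map π := by
      rw [commutator_def, Subgroup.map_commutator, ← MonoidHom.range_eq_map,
        MonoidHom.range_eq_top.mpr hsurj, ← commutator_def, commutator_eq_top hp5]
      trivial
    obtain ⟨d, hd, hdg⟩ := hg
    exact ⟨d, hd, d⁻¹ * g, by rw [map_mul, map_inv, hdg, inv_mul_cancel], by group⟩
  -- D is perfect: ⁅⊤, ⊤⁆ ≤ ⁅D, D⁆
  have hDD : commutator E ≤ ⁅D, D⁆ := by
    rw [commutator_def, Subgroup.commutator_def, Subgroup.closure_le]
    rintro _ ⟨g, -, h, -, rfl⟩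
    obtain ⟨d₁, hd₁, ζ₁, hζ₁, rfl⟩ := hdec g
    obtain ⟨d₂, hd₂, ζ₂, hζ₂, rfl⟩ := hdec h
    have : ⁅d₁ * ζ₁, d₂ * ζ₂⁆ = ⁅d₁, d₂⁆ := by
      simp only [commutatorElement_def]
      have c1 := hcen ζ₁ hζ₁
      have c2 := hcen ζ₂ hζ₂
      calc d₁ * ζ₁ * (d₂ * ζ₂) * (d₁ * ζ₁)⁻¹ * (d₂ * ζ₂)⁻¹
          = d₁ * (ζ₁ * d₂) * ζ₂ * ζ₁⁻¹ * d₁⁻¹ * ζ₂⁻¹ * d₂⁻¹ := by group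
        _ = d₁ * (d₂ * ζ₁) * ζ₂ * ζ₁⁻¹ * d₁⁻¹ * ζ₂⁻¹ * d₂⁻¹ := by rw [c1 d₂]
        _ = d₁ * d₂ * (ζ₁ * ζ₂) * ζ₁⁻¹ * d₁⁻¹ * ζ₂⁻¹ * d₂⁻¹ := by group
        _ = d₁ * d₂ * (ζ₂ * ζ₁) * ζ₁⁻¹ * d₁⁻¹ * ζ₂⁻¹ * d₂⁻¹ := by rw [c2 ζ₁]
        _ = d₁ * d₂ * ζ₂ * (d₁⁻¹ * ζ₂⁻¹) * d₂⁻¹ := by group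
        _ = d₁ * d₂ * ζ₂ * (ζ₂⁻¹ * d₁⁻¹) * d₂⁻¹ := by
            rw [show d₁⁻¹ * ζ₂⁻¹ = ζ₂⁻¹ * d₁⁻¹ from by
              rw [← _root_.mul_inv_rev, ← _root_.mul_inv_rev, c2 d₁]]
        _ = d₁ * d₂ * d₁⁻¹ * d₂⁻¹ := by group
    rw [this]
    exact Subgroup.commutator_mem_commutator hd₁ hd₂
  have hDperf : commutator D = ⊤ := by
    rw [eq_top_iff]
    rintro ⟨x, hx⟩ -
    have h1 : x ∈ (commutator D).map D.subtype := by
      rw [commutator_def, Subgroup.map_commutator, ← MonoidHom.range_eq_map, Subgroup.range_subtype]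
      exact hDD (by rw [← hD]; exact hx)
    obtain ⟨y, hy, hyx⟩ := h1
    have : y = ⟨x, hx⟩ := Subtype.ext hyx
    rwa [this] at hy
  -- the central extension D → SL₂(ℤ/p^e)
  set πD : D →* SL(2, ZMod (p ^ e)) := π.comp D.subtype with hπD
  have hπDs : Function.Surjective πD := by
    intro X
    obtain ⟨g, hg⟩ := hsurj X
    obtain ⟨d, hd, ζ, hζ, rfl⟩ := hdec g
    exact ⟨⟨d, hd⟩, by rw [hπD, MonoidHom.comp_apply, Subgroup.coe_subtype, ← hg, map_mul, hζ, mul_one]⟩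
  set K : Subgroup D := πD.ker with hK
  have memK : ∀ x : D, x ∈ K ↔ π (x : E) = 1 := fun x ↦ by rw [hK, MonoidHom.mem_ker]; rfl
  have hKc : ∀ x ∈ K, ∀ g : D, g * x = x * g := fun x hx g ↦
    Subtype.ext (hcen _ ((memK x).mp hx) _)
  -- the subgroup generated by the p-th powers of the kernel
  set Kp : Subgroup D := Subgroup.closure {y : D | ∃ k ∈ K, y = k ^ p} with hKp
  have hKpK : Kp ≤ K := by
    rw [hKp, Subgroup.closure_le]; rintro _ ⟨k, hk, rfl⟩; exact K.pow_mem hk p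
  have hKpc : ∀ x ∈ Kp, ∀ g : D, g * x = x * g := fun x hx g ↦ hKc x (hKpK hx) g
  haveI : Kp.Normal := ⟨fun x hx g ↦ by
    have : g * x * g⁻¹ = x := by rw [hKpc x hx g, mul_inv_cancel_right]
    rw [this]; exact hx⟩
  have hKpker : Kp ≤ πD.ker := hKpK
  set π' : D ⧸ Kp →* SL(2, ZMod (p ^ e)) := QuotientGroup.lift Kp πD hKpker with hπ'
  have hπ'mk : ∀ x : D, π' (QuotientGroup.mk x) = πD x := fun x ↦ rfl
  have hsurj' : Function.Surjective π' := by
    intro X; obtain ⟨x, hx⟩ := hπDs X; exact ⟨QuotientGroup.mk x, by rw [hπ'mk, hx]⟩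
  have hcen' : ∀ q : D ⧸ Kp, π' q = 1 → ∀ g : D ⧸ Kp, g * q = q * g := by
    intro q hq g
    induction q using QuotientGroup.induction_on with
    | H x =>
      induction g using QuotientGroup.induction_on with
      | H y =>
        rw [hπ'mk] at hq
        rw [← QuotientGroup.mk_mul, ← QuotientGroup.mk_mul, hKc x hq y]
  have hexp' : ∀ q : D ⧸ Kp, π' q = 1 → q ^ p = 1 := by
    intro q hq
    induction q using QuotientGroup.induction_on with
    | H x =>
      rw [hπ'mk] at hq
      rw [← QuotientGroup.mk_pow, QuotientGroup.eq_one_iff]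
      exact Subgroup.subset_closure ⟨x, hq, rfl⟩
  -- the exponent-p theorem forces K ≤ Kp
  have hKKp : K ≤ Kp := by
    intro k hk
    have h1 : π' (QuotientGroup.mk k) = 1 := by rw [hπ'mk]; exact hk
    have h2 : (QuotientGroup.mk k : D ⧸ Kp) ∈ commutator (D ⧸ Kp) := by
      have := Subgroup.mem_map_of_mem (QuotientGroup.mk' Kp) (show k ∈ commutator D by rw [hDperf]; trivial)
      rw [commutator_def, Subgroup.map_commutator] at this
      rw [commutator_def]
      exact Subgroup.commutator_mono le_top le_top this
    have h3 := SL2SchurMultiplier.eq_one_of_mem_ker_of_mem_commutator p hp5 e π' hsurj' hcen' hexp' h1 h2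
    exact (QuotientGroup.eq_one_iff k).mp h3
  -- hence K = 1: powers p^n
  have hpow : ∀ n : ℕ, ∀ k ∈ K, k ∈ Subgroup.closure {y : D | ∃ k' ∈ K, y = k' ^ (p ^ n)} := by
    intro n
    induction n with
    | zero => intro k hk; exact Subgroup.subset_closure ⟨k, hk, by rw [pow_zero, pow_one]⟩
    | succ n ih =>
      intro k hk
      -- k ∈ Kp; push through the p^n-th power statement
      have hk' := hKKp hk
      rw [hKp] at hk'
      -- every element of the closure of p-th powers is, after the inductive hypothesis, in the target
      refine Subgroup.closure_induction (p := fun (x : D) _ ↦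
          x ∈ Subgroup.closure {y : D | ∃ k' ∈ K, y = k' ^ (p ^ (n + 1))}) ?_ ?_ ?_ ?_ hk'
      · rintro _ ⟨k₁, hk₁, rfl⟩
        -- k₁ ∈ closure {k'^(p^n)} by ih; its p-th power lies in closure {k'^(p^(n+1))}
        have hk₁' := ih k₁ hk₁
        refine Subgroup.closure_induction (p := fun (x : D) _ ↦
            x ∈ K → x ^ p ∈ Subgroup.closure {y : D | ∃ k' ∈ K, y = k' ^ (p ^ (n + 1))}) ?_ ?_ ?_ ?_ hk₁' hk₁
        · rintro _ ⟨k₂, hk₂, rfl⟩ -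
          exact Subgroup.subset_closure ⟨k₂, hk₂, by rw [← pow_mul, pow_succ]⟩
        · intro _; rw [one_pow]; exact Subgroup.one_mem _
        · intro x y hx hy ihx ihy hxy
          -- x, y ∈ K? we only know x * y ∈ K; use closures ≤ K
          have hxK : x ∈ K := (Subgroup.closure_le (K := K)).mpr
            (by rintro _ ⟨k', hk', rfl⟩; exact K.pow_mem hk' _) hx
          have hyK : y ∈ K := (Subgroup.closure_le (K := K)).mpr
            (by rintro _ ⟨k', hk', rfl⟩; exact K.pow_mem hk' _) hy
          have hc : Commute x y := hKc y hyK x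
          rw [hc.mul_pow]
          exact Subgroup.mul_mem _ (ihx hxK) (ihy hyK)
        · intro x hx ihx hxinv
          have hxK : x ∈ K := by simpa using K.inv_mem hxinv
          rw [inv_pow]
          exact Subgroup.inv_mem _ (ihx hxK)
      · exact Subgroup.one_mem _
      · intro x y _ _ hx hy; exact Subgroup.mul_mem _ hx hy
      · intro x _ hx; exact Subgroup.inv_mem _ hx
  have hK1 : ∀ k ∈ K, k = 1 := by
    intro k hk
    have h := hpow a k hk
    have hbot : Subgroup.closure {y : D | ∃ k' ∈ K, y = k' ^ (p ^ a)} = ⊥ := by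
      rw [Subgroup.closure_eq_bot_iff]
      rintro _ ⟨k', hk', rfl⟩
      simp only [Set.mem_singleton_iff]
      apply Subtype.ext
      rw [Subgroup.coe_pow, Subgroup.coe_one]
      exact hexp _ ((memK k').mp hk')
    rw [hbot, Subgroup.mem_bot] at h
    exact h
  have : (⟨z, hzc⟩ : D) = 1 := hK1 _ ((memK _).mpr hz)
  exact congr_arg Subtype.val this

end SL2SchurMultiplierPGroup

end Literature.GroupTheory.ArithmeticGroups
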